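import Summits.CriticalPhenomena.Ising3DConformalLimit.Theses.ReflectionTwin
import Summits.CriticalPhenomena.Ising3DConformalLimit.Theorems.LogPolarProxyExistsContinuousLimitDoublingSplit
import Summits.CriticalPhenomena.Ising3DConformalLimit.Theorems.PrecisionLaplacianMoebiusLimitOfTwoPointLawInversionBegetsRotations
import Summits.CriticalPhenomena.Ising3DConformalLimit.Theorems.MoebiusLimitExists.Negative.CompactnessContent
import Summits.CriticalPhenomena.Ising3DConformalLimit.Theorems.EnergyNotSigmaSquaredMoebiusLimitExistsDefs
import Summits.CriticalPhenomena.Ising3DConformalLimit.Theorems.ReflectionTwinExistsContinuousLimitInversionBegetsDilation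
import HarnessLib

/-!
# Crux `ExistsContinuousLimit` (stmt-CriticalPhenomena-4582) ⟸ item 6150 ∧ K1′ ∧ TD — the by-name reduction
# of line `Sketch` (= idea `inversion-before-existence`), with K2 and the rotation half LANDED

Routes `ReflectionTwin` / `LogPolarProxy` (sub-problem `CriticalPhenomena/Ising3DConformalLimit`), shared crux
`ReflectionTwin.ExistsContinuousLimit = LogPolarProxy.ExistsContinuousLimit` (one term): the OPEN existence problem
of the critical `ℤ³` Ising spin scaling limit (Duminil-Copin, ICM 2022, §8.4). Nothing here proves it. This file
lands, kernel-checked, the composition of line `Sketch` (`Cruxes/ExistsContinuousLimit/Lines/Sketch.lean`) so that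
the ledger sees the crux's exact remaining debt BY NAME:

* `clusterPointsMoebius_of_doubling_of_inversionCovariant` (registered sub-goal) — **item 6150
  `MirrorHoelderCompactness.TwoPointDoubling` ∧ K1′ ⟹ every member of the cluster set of item 4659 is
  non-degenerate and Möbius covariant for some `Δ`** (item 4657 `ClusterRigidity.ClusterPointsMoebius` up to its
  sign clause `0 < Δ`). K1′ = `stub_clusterPointInversionCovariant` (OPEN): every normalised cluster point of the
  pinned zoom is covariant under the unit inversion with SOME continuous positive weight. Engines: non-degeneracy of
  cluster points under 6150 (`orbitPrecompact_iff_doubling`, `tight_nhdsGT`, `clusterPoint_nondeg_of_compactness`),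
  free translation invariance / continuity of sequential limits (`seqLimit_translate`, `continuousOn_seqLimit`), the
  LANDED weighted cocycle rigidity K2 `stub_inversionBegetsDilation` (p155261 + p155681: translations + one weighted
  inversion ⟹ scale AND inversion covariance with one `Δ`) and the LANDED rotation half item 4675
  `stub_inversionBegetsRotations` (p86170).
* `existsContinuousLimit_of_doubling_of_inversionCovariant_of_isolated` (registered sub-goal) — **item 6150 ∧ K1′ ∧
  TD ⟹ the crux**, TD = `stub_isolatedConformalClusterPoints` (OPEN, CFT-side isolation): the non-degenerate
  Möbius-covariant members of the cluster set of item 4659 form a totally disconnected set; under 6150 ∧ K1′ that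
  subset is the whole cluster set (`clusterSet_eq_conformal`), so TD gives item 4659 and the landed split
  `reflectionTwin_existsContinuousLimit_of_doubling_of_totallyDisconnected` (p149785) closes the crux by name.

No `sorry`, no definitions, no new hypotheses beyond the two open stub statements (spelled out) and item 6150 by
name. [folklore]
-/

noncomputable section

namespace Summit.CriticalPhenomena.Ising3DConformalLimit.ReflectionTwinExistsContinuousLimit

open Literature.Probability.LatticeModels Filter Set
open scoped Topology
open Summit.CriticalPhenomena.Ising3DConformalLimit.MoebiusLimitExistsOnlyInteraction (rhoPin IsClusterPoint)
open Summit.CriticalPhenomena.Ising3DConformalLimit.Theses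
open Summit.CriticalPhenomena.Ising3DConformalLimit.Cruxes.ExistsScaleCovariantLimit.TwoHierarchies
  (seqLimit_translate continuousOn_seqLimit rhoStar_eq_rhoPin)
open Summit.CriticalPhenomena.Ising3DConformalLimit.Cruxes.ExistsScaleCovariantLimit.TwoHierarchies.ItemMaps
  (orbitPrecompact_iff_doubling)
open Summit.CriticalPhenomena.Ising3DConformalLimit.Cruxes.ExistsScaleCovariantLimit.FoldedCurrentRepulsion.Uniqueness
  (tight_nhdsGT)
open Summit.CriticalPhenomena.Ising3DConformalLimit.MoebiusLimitExistsNegative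
  (clusterPoint_nondeg_of_compactness clusterPoint_two_conv)
open Summit.CriticalPhenomena.Ising3DConformalLimit.PrecisionLaplacianMoebiusLimitOfTwoPointLaw
  (stub_inversionBegetsRotations)
open Summit.CriticalPhenomena.Ising3DConformalLimit.LogPolarProxyExistsContinuousLimit
  (reflectionTwin_existsContinuousLimit_of_doubling_of_totallyDisconnected)

/-! ### Cluster points under item 6150: non-degeneracy, translations, continuity -/

/-- **Under item 6150 every cluster point of the pinned zoom is non-degenerate** (all-scale doubling ⟹ orbit
precompactness `orbitPrecompact_iff_doubling` ⟹ tightness along every mesh sequence `tight_nhdsGT` ⟹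
`clusterPoint_nondeg_of_compactness`: a zero of `S₂` would make the pinned zoom blow up at a rescaled pair).
[folklore] -/
theorem isNondegenerateTwoPoint_of_isClusterPoint (hD : MirrorHoelderCompactness.TwoPointDoubling)
    {S : CorrFamily 3} (hS : IsClusterPoint S) : IsNondegenerateTwoPoint S := by
  have hpc : MonotoneRG.OrbitPrecompact := orbitPrecompact_iff_doubling.2 hD
  refine clusterPoint_nondeg_of_compactness (fun u hu => ?_) (clusterPoint_two_conv hS)
  obtain ⟨φ, hφ, S', hS'⟩ := tight_nhdsGT hpc hu
  exact ⟨φ, S', hφ, hS' 2⟩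

/-- A normalised cluster point of the pinned zoom is translation invariant at EVERY configuration (off the diagonals
by `seqLimit_translate`; on them both sides vanish). [folklore] -/
theorem isTranslationInvariant_of_isClusterPoint {S : CorrFamily 3}
    (hN : ∀ n z, z ∉ NonCoincident 3 n → S n z = 0) (hS : IsClusterPoint S) : IsTranslationInvariant S := by
  obtain ⟨u, hu, hconv⟩ := hS
  intro n v x
  by_cases hx : x ∈ NonCoincident 3 n
  · exact seqLimit_translate hu (hconv n) v hx
  · have hx' : (fun i => x i + v) ∉ NonCoincident 3 n := by
      intro h
      apply hx
      rw [mem_nonCoincident] at h ⊢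
      intro i j hij
      exact h (by simp [hij])
    rw [hN n _ hx', hN n x hx]

/-- **Item 6150 ∧ K1′ ⟹ every normalised cluster point of the pinned `ℤ³` zoom is non-degenerate and Möbius
covariant with some exponent `Δ`** (K1′ supplies a weighted unit inversion; the landed K2
`stub_inversionBegetsDilation` turns it, with the free translations, into scale and inversion covariance with one
`Δ`; the landed item 4675 `stub_inversionBegetsRotations` adds `O(3)`). [folklore] -/
theorem clusterPoint_moebius_of_inversionCovariant (hD : MirrorHoelderCompactness.TwoPointDoubling)
    (hK1 : ∀ S : CorrFamily 3, (∀ n z, z ∉ NonCoincident 3 n → S n z = 0) → IsClusterPoint S →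
      ∃ w : EuclideanSpace ℝ (Fin 3) → ℝ, (∀ v, v ≠ 0 → 0 < w v) ∧ ContinuousOn w {0}ᶜ ∧
        ∀ (n : ℕ) (x : Fin n → EuclideanSpace ℝ (Fin 3)), (∀ i, x i ≠ 0) →
          S n (fun i => EuclideanGeometry.inversion (0 : EuclideanSpace ℝ (Fin 3)) 1 (x i)) =
            (∏ i, w (x i)) * S n x)
    {S : CorrFamily 3} (hN : ∀ n z, z ∉ NonCoincident 3 n → S n z = 0) (hS : IsClusterPoint S) :
    IsNondegenerateTwoPoint S ∧ ∃ Δ : ℝ, IsMoebiusCovariant Δ S := by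
  have hnd : IsNondegenerateTwoPoint S := isNondegenerateTwoPoint_of_isClusterPoint hD hS
  have htr : IsTranslationInvariant S := isTranslationInvariant_of_isClusterPoint hN hS
  have hcont : ∀ n, ContinuousOn (S n) (NonCoincident 3 n) := by
    obtain ⟨u, hu, hconv⟩ := hS
    exact fun n => continuousOn_seqLimit hu (hconv n)
  obtain ⟨w, hwpos, hwcont, hcov⟩ := hK1 S hN hS
  obtain ⟨Δ, hsc, hinv⟩ := stub_inversionBegetsDilation S hN hcont htr hnd w hwpos hwcont hcov
  have hrot : IsRotationInvariant S := stub_inversionBegetsRotations Δ S htr hinv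
  exact ⟨hnd, Δ, ⟨htr, hrot⟩, hsc, hinv⟩

/-- A member of the cluster set of item 4659 is a cluster point of the pinned zoom (`IsClusterPoint`): meshes in
`(0,1]` tending to `0` tend to `0⁺`, and the items' renormalisation is `ρ_pin` (`rhoStar_eq_rhoPin`). [folklore] -/
theorem isClusterPoint_of_mem {S : CorrFamily 3} {u : ℕ → ℝ} (hu1 : ∀ k, u k ∈ Set.Ioc (0:ℝ) 1)
    (hu : Tendsto u atTop (𝓝 0))
    (hconv : ∀ n, TendstoLocallyUniformlyOn
      (fun k => rescaledCorrelator (criticalCorr 3)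
        (fun δ : ℝ => (criticalTwoPoint 3 (Pi.single 0 ⌊δ⁻¹⌋)) ^ (-(1 / 2 : ℝ))) n (u k))
      (S n) atTop (NonCoincident 3 n)) : IsClusterPoint S := by
  refine ⟨u, tendsto_nhdsWithin_iff.2 ⟨hu, Eventually.of_forall fun k => (hu1 k).1⟩, fun n => ?_⟩
  rw [← rhoStar_eq_rhoPin]
  exact hconv n

/-- **Registered sub-goal `clusterPointsMoebius_of_doubling_of_inversionCovariant`: item 6150 ∧ K1′ ⟹ every member
of the cluster set of item 4659 is non-degenerate and Möbius covariant for some `Δ`** — item 4657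
`ClusterRigidity.ClusterPointsMoebius` up to its sign clause `0 < Δ`, BEFORE existence is known. [folklore] -/
theorem clusterPointsMoebius_of_doubling_of_inversionCovariant :
    Summit.CriticalPhenomena.Ising3DConformalLimit.Theses.MirrorHoelderCompactness.TwoPointDoubling →
    (∀ S : Literature.Probability.LatticeModels.CorrFamily 3,
      (∀ n z, z ∉ Literature.Probability.LatticeModels.NonCoincident 3 n → S n z = 0) →
      Summit.CriticalPhenomena.Ising3DConformalLimit.MoebiusLimitExistsOnlyInteraction.IsClusterPoint S →
      ∃ w : EuclideanSpace ℝ (Fin 3) → ℝ, (∀ v, v ≠ 0 → 0 < w v) ∧ ContinuousOn w {0}ᶜ ∧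
        ∀ (n : ℕ) (x : Fin n → EuclideanSpace ℝ (Fin 3)), (∀ i, x i ≠ 0) →
          S n (fun i => EuclideanGeometry.inversion (0 : EuclideanSpace ℝ (Fin 3)) 1 (x i)) =
            (∏ i, w (x i)) * S n x) →
    ∀ S : Literature.Probability.LatticeModels.CorrFamily 3,
      ((∀ n x, x ∉ Literature.Probability.LatticeModels.NonCoincident 3 n → S n x = 0) ∧
        ∃ u : ℕ → ℝ, (∀ k, u k ∈ Set.Ioc (0:ℝ) 1) ∧ Filter.Tendsto u Filter.atTop (nhds 0) ∧
          ∀ n, TendstoLocallyUniformlyOn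
            (fun k => Literature.Probability.LatticeModels.rescaledCorrelator
              (Literature.Probability.LatticeModels.criticalCorr 3)
              (fun δ : ℝ => (Literature.Probability.LatticeModels.criticalTwoPoint 3 (Pi.single 0 ⌊δ⁻¹⌋)) ^
                (-(1/2:ℝ))) n (u k))
            (S n) Filter.atTop (Literature.Probability.LatticeModels.NonCoincident 3 n)) →
      Literature.Probability.LatticeModels.IsNondegenerateTwoPoint S ∧
        ∃ Δ : ℝ, Literature.Probability.LatticeModels.IsMoebiusCovariant Δ S := by
  rintro hD hK1 S ⟨hN, u, hu1, hu, hconv⟩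
  exact clusterPoint_moebius_of_inversionCovariant hD hK1 hN (isClusterPoint_of_mem hu1 hu hconv)

/-! ### The crux from item 6150, K1′ and TD -/

/-- **Under item 6150 and K1′ the cluster set of item 4659 coincides with its non-degenerate Möbius-covariant
part.** [folklore] -/
theorem clusterSet_eq_conformal (hD : MirrorHoelderCompactness.TwoPointDoubling)
    (hK1 : ∀ S : CorrFamily 3, (∀ n z, z ∉ NonCoincident 3 n → S n z = 0) → IsClusterPoint S →
      ∃ w : EuclideanSpace ℝ (Fin 3) → ℝ, (∀ v, v ≠ 0 → 0 < w v) ∧ ContinuousOn w {0}ᶜ ∧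
        ∀ (n : ℕ) (x : Fin n → EuclideanSpace ℝ (Fin 3)), (∀ i, x i ≠ 0) →
          S n (fun i => EuclideanGeometry.inversion (0 : EuclideanSpace ℝ (Fin 3)) 1 (x i)) =
            (∏ i, w (x i)) * S n x) :
    {S : CorrFamily 3 |
      ((∀ n x, x ∉ NonCoincident 3 n → S n x = 0) ∧
        ∃ u : ℕ → ℝ, (∀ k, u k ∈ Set.Ioc (0:ℝ) 1) ∧ Tendsto u atTop (𝓝 0) ∧
          ∀ n, TendstoLocallyUniformlyOn
            (fun k => rescaledCorrelator (criticalCorr 3)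
              (fun δ : ℝ => (criticalTwoPoint 3 (Pi.single 0 ⌊δ⁻¹⌋)) ^ (-(1/2:ℝ))) n (u k))
            (S n) atTop (NonCoincident 3 n)) ∧
      IsNondegenerateTwoPoint S ∧ ∃ Δ : ℝ, IsMoebiusCovariant Δ S} =
    {S : CorrFamily 3 |
      (∀ n x, x ∉ NonCoincident 3 n → S n x = 0) ∧
        ∃ u : ℕ → ℝ, (∀ k, u k ∈ Set.Ioc (0:ℝ) 1) ∧ Tendsto u atTop (𝓝 0) ∧
          ∀ n, TendstoLocallyUniformlyOn
            (fun k => rescaledCorrelator (criticalCorr 3)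
              (fun δ : ℝ => (criticalTwoPoint 3 (Pi.single 0 ⌊δ⁻¹⌋)) ^ (-(1/2:ℝ))) n (u k))
            (S n) atTop (NonCoincident 3 n)} := by
  ext S
  simp only [Set.mem_setOf_eq]
  constructor
  · exact fun h => h.1
  · intro h
    exact ⟨h, clusterPointsMoebius_of_doubling_of_inversionCovariant hD hK1 S h⟩

/-- **Registered sub-goal `existsContinuousLimit_of_doubling_of_inversionCovariant_of_isolated`: item 6150 ∧ K1′ ∧
TD ⟹ the crux `ReflectionTwin.ExistsContinuousLimit`** (by name). TD restricted to the conformal cluster points is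
item 4659 once `clusterSet_eq_conformal` identifies the two sets; the landed split p149785 does the rest. [folklore] -/
theorem existsContinuousLimit_of_doubling_of_inversionCovariant_of_isolated :
    Summit.CriticalPhenomena.Ising3DConformalLimit.Theses.MirrorHoelderCompactness.TwoPointDoubling →
    (∀ S : Literature.Probability.LatticeModels.CorrFamily 3,
      (∀ n z, z ∉ Literature.Probability.LatticeModels.NonCoincident 3 n → S n z = 0) →
      Summit.CriticalPhenomena.Ising3DConformalLimit.MoebiusLimitExistsOnlyInteraction.IsClusterPoint S →
      ∃ w : EuclideanSpace ℝ (Fin 3) → ℝ, (∀ v, v ≠ 0 → 0 < w v) ∧ ContinuousOn w {0}ᶜ ∧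
        ∀ (n : ℕ) (x : Fin n → EuclideanSpace ℝ (Fin 3)), (∀ i, x i ≠ 0) →
          S n (fun i => EuclideanGeometry.inversion (0 : EuclideanSpace ℝ (Fin 3)) 1 (x i)) =
            (∏ i, w (x i)) * S n x) →
    IsTotallyDisconnected {S : Literature.Probability.LatticeModels.CorrFamily 3 |
      ((∀ n x, x ∉ Literature.Probability.LatticeModels.NonCoincident 3 n → S n x = 0) ∧
        ∃ u : ℕ → ℝ, (∀ k, u k ∈ Set.Ioc (0:ℝ) 1) ∧ Filter.Tendsto u Filter.atTop (nhds 0) ∧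
          ∀ n, TendstoLocallyUniformlyOn
            (fun k => Literature.Probability.LatticeModels.rescaledCorrelator
              (Literature.Probability.LatticeModels.criticalCorr 3)
              (fun δ : ℝ => (Literature.Probability.LatticeModels.criticalTwoPoint 3 (Pi.single 0 ⌊δ⁻¹⌋)) ^
                (-(1/2:ℝ))) n (u k))
            (S n) Filter.atTop (Literature.Probability.LatticeModels.NonCoincident 3 n)) ∧
      Literature.Probability.LatticeModels.IsNondegenerateTwoPoint S ∧
      ∃ Δ : ℝ, Literature.Probability.LatticeModels.IsMoebiusCovariant Δ S} →
    Summit.CriticalPhenomena.Ising3DConformalLimit.Theses.ReflectionTwin.ExistsContinuousLimit := by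
  intro hD hK1 hTD
  refine reflectionTwin_existsContinuousLimit_of_doubling_of_totallyDisconnected hD ?_
  unfold ClusterRigidity.ClusterSetTotallyDisconnected
  rw [← clusterSet_eq_conformal hD hK1]
  exact hTD

/-- The `LogPolarProxy` copy of the crux from the same three inputs (the two route decls are one term). [folklore] -/
theorem logPolarProxy_existsContinuousLimit_of_doubling_of_inversionCovariant_of_isolated
    (hD : MirrorHoelderCompactness.TwoPointDoubling)
    (hK1 : ∀ S : CorrFamily 3, (∀ n z, z ∉ NonCoincident 3 n → S n z = 0) → IsClusterPoint S →
      ∃ w : EuclideanSpace ℝ (Fin 3) → ℝ, (∀ v, v ≠ 0 → 0 < w v) ∧ ContinuousOn w {0}ᶜ ∧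
        ∀ (n : ℕ) (x : Fin n → EuclideanSpace ℝ (Fin 3)), (∀ i, x i ≠ 0) →
          S n (fun i => EuclideanGeometry.inversion (0 : EuclideanSpace ℝ (Fin 3)) 1 (x i)) =
            (∏ i, w (x i)) * S n x)
    (hTD : IsTotallyDisconnected {S : CorrFamily 3 |
      ((∀ n x, x ∉ NonCoincident 3 n → S n x = 0) ∧
        ∃ u : ℕ → ℝ, (∀ k, u k ∈ Set.Ioc (0:ℝ) 1) ∧ Tendsto u atTop (𝓝 0) ∧
          ∀ n, TendstoLocallyUniformlyOn
            (fun k => rescaledCorrelator (criticalCorr 3)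
              (fun δ : ℝ => (criticalTwoPoint 3 (Pi.single 0 ⌊δ⁻¹⌋)) ^ (-(1/2:ℝ))) n (u k))
            (S n) atTop (NonCoincident 3 n)) ∧
      IsNondegenerateTwoPoint S ∧ ∃ Δ : ℝ, IsMoebiusCovariant Δ S}) :
    LogPolarProxy.ExistsContinuousLimit :=
  existsContinuousLimit_of_doubling_of_inversionCovariant_of_isolated hD hK1 hTD

end Summit.CriticalPhenomena.Ising3DConformalLimit.ReflectionTwinExistsContinuousLimit

end
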